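import Summits.Ventures.LatticeQCDFlow.Scaling.ApproximateEigenfunctionFloor
import Summits.Ventures.LatticeQCDFlow.Scaling.ReplicaExchangeGraphSwap
import Summits.Ventures.LatticeQCDFlow.Scaling.LadderStaleWeights

/-!
HONEST FRAMING: exact (Metropolis-corrected) sampling algorithms for lattice gauge theory; figures
of merit are autocorrelation/cost numbers at stated couplings and volumes; no continuum-physics
claim.

# GraphSchemeStaleWeights — THE STALE-SET CHAIN OF A HOMOGENEOUS EXCHANGE SCHEME ON ANY SWAP LIST (`D ↦ (i_r l_r)(D)` w.p. `t/m` EACH, `D ↦ D∖{0}` w.p. `h`, ELSE IDLE): A SOLUTION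
# OF THE VERTEX EQUATIONS IS AN EXACT LYAPUNOV WEIGHT, `E[Σ_{k∈D'}c_k] = (1−ρ)Σ_{k∈D}c_k`, AND **`P_{D_0}(D_n ≠ ∅) ≤ (1−ρ)ⁿ·F(D_0)/c_min`** (lean-2 GEN-47, ours)

Venture-side (OURS).  Cell `lqcd-flow` (pub-lqcd), unit `pub-lqcd-lean-2-g47`, 2026-08-31.  Chapter AH (the hub–ladder interpolation), file 4 — the ceiling side at the set-chain level for ANY
swap list `e : Fin m → (levels)²` (chapter AG file 6 is the path, chapter L file 12 the hub list with a different potential).  The stale set of the lazy homogeneous scheme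
`t·GSw_e + h·R + (1−t−h)·I` is the autonomous chain `Q`: entry `r` transposes the labels `i_r, l_r` of `D` (probability `t/m`), a hot redraw deletes `0` (probability `h`).  For ANY weight
vector `c` on the levels, `E[F(D') | D] − F(D) = Σ_{k∈D}[(t/m)Σ_r(1{k=i_r}(c_{l_r}−c_{i_r}) + 1{k=l_r}(c_{i_r}−c_{l_r})) − h1{k=0}c_0]` — the matrix of file 1 — so under the VERTEX
EQUATIONS (`Qc = (1−ρ)c`) `F(D) = Σ_{k∈D}c_k` is an exact eigenfunction of the set chain and, when every `c_k ≥ c_min > 0`, Markov's inequality bounds the survival of staleness.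
Hypothesis-equation `hQ`; no definitions.

* §1 **`graphStale_sum_mul`** (with chapter AG file 6's `sum_indicator_mul`) (one-step action on any test function), `graphStale_isRowStochastic`; `staleWeight_image_swap` (`F((i l)D) = Σ_{k∈D}c_{(i l)k}`),
  `staleWeight_erase'`, `swap_coeff_diff` (`c_{(i l)k} − c_k = 1{k=i}(c_l − c_i) + 1{k=l}(c_i − c_l)`).
* §2 **`graphStale_weight_eigen`** (`Σ_{D'}Q(D,D')F(D') = (1−ρ)F(D)`), **`graphStale_weight_lawAt`** (`E[F(D_n)] = (1−ρ)ⁿF(D_0)`), **`graphStale_nonempty_le`**.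

Literature grade (cell rule): ELEMENTARY, NEW TYPING; nothing cited; no new bib keys.
-/

noncomputable section

open Finset Function
open Literature.Probability.MarkovChains

namespace Summit.Ventures.LatticeQCDFlow.Scaling

section GraphStale
variable {K m : ℕ} (e : Fin m → Fin (K + 1) × Fin (K + 1)) {t h : ℝ} {Q : Finset (Fin (K + 1)) → Finset (Fin (K + 1)) → ℝ} {c : Fin (K + 1) → ℝ}

/-! ## §1 The stale-set chain on a swap list -/

/-- **THE ONE-STEP ACTION ON ANY TEST FUNCTION:** `Σ_{D'}Q(D,D')G(D') = (t/m)Σ_rG((i_r l_r)D) + h·G(D∖{0}) + (1−t−h)·G(D)`. [ours] -/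
theorem graphStale_sum_mul
    (hQ : ∀ D D', Q D D' = (∑ r : Fin m, t / m * (if D' = D.image (Equiv.swap (e r).1 (e r).2) then (1 : ℝ) else 0))
      + h * (if D' = D.erase 0 then (1 : ℝ) else 0) + (1 - t - h) * (if D' = D then (1 : ℝ) else 0))
    (D : Finset (Fin (K + 1))) (G : Finset (Fin (K + 1)) → ℝ) :
    ∑ D', Q D D' * G D' = t / m * ∑ r : Fin m, G (D.image (Equiv.swap (e r).1 (e r).2)) + h * G (D.erase 0) + (1 - t - h) * G D := by
  have e' : ∀ D', Q D D' * G D' = (∑ r : Fin m, t / m * ((if D' = D.image (Equiv.swap (e r).1 (e r).2) then (1 : ℝ) else 0) * G D'))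
      + h * ((if D' = D.erase 0 then (1 : ℝ) else 0) * G D') + (1 - t - h) * ((if D' = D then (1 : ℝ) else 0) * G D') := by
    intro D'; rw [hQ, add_mul, add_mul, sum_mul]; congr 1; congr 1
    · exact sum_congr rfl fun j _ => by ring
    · ring
    · ring
  simp_rw [e']
  rw [sum_add_distrib, sum_add_distrib, ← mul_sum, ← mul_sum, sum_indicator_mul, sum_indicator_mul, sum_comm]
  simp_rw [← mul_sum, sum_indicator_mul]

/-- **The stale-set chain is a transition matrix** (`m ≥ 1`, `t, h ≥ 0`, `t + h ≤ 1`). [ours] -/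
theorem graphStale_isRowStochastic (hm : 1 ≤ m) (ht0 : 0 ≤ t) (hh0 : 0 ≤ h) (hth : t + h ≤ 1)
    (hQ : ∀ D D', Q D D' = (∑ r : Fin m, t / m * (if D' = D.image (Equiv.swap (e r).1 (e r).2) then (1 : ℝ) else 0))
      + h * (if D' = D.erase 0 then (1 : ℝ) else 0) + (1 - t - h) * (if D' = D then (1 : ℝ) else 0)) : IsRowStochastic Q := by
  have hmpos : (0 : ℝ) < m := Nat.cast_pos.mpr (by omega)
  refine ⟨fun D D' => ?_, fun D => ?_⟩
  · rw [hQ]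
    exact add_nonneg (add_nonneg (sum_nonneg fun j _ => mul_nonneg (by positivity) (by split_ifs <;> norm_num))
      (mul_nonneg hh0 (by split_ifs <;> norm_num))) (mul_nonneg (by linarith) (by split_ifs <;> norm_num))
  · have h1 := graphStale_sum_mul e hQ D (fun _ => (1 : ℝ))
    simp only [mul_one, sum_const, card_univ, Fintype.card_fin, nsmul_eq_mul] at h1
    rw [h1]; field_simp; ring

/-- `F((i l)D) = Σ_{k∈D} c_{(i l)k}`. [ours] -/
theorem staleWeight_image_swap (c : Fin (K + 1) → ℝ) (i l : Fin (K + 1)) (D : Finset (Fin (K + 1))) :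
    ∑ k ∈ D.image (Equiv.swap i l), c k = ∑ k ∈ D, c (Equiv.swap i l k) := by
  rw [Finset.sum_image fun x _ y _ hxy => (Equiv.swap i l).injective hxy]

/-- `F(D∖{0}) = F(D) − 1{0 ∈ D}·c_0`. [ours] -/
theorem staleWeight_erase' (c : Fin (K + 1) → ℝ) (D : Finset (Fin (K + 1))) :
    ∑ k ∈ D.erase 0, c k = ∑ k ∈ D, c k - (if (0 : Fin (K + 1)) ∈ D then c 0 else 0) := by
  by_cases h0 : (0 : Fin (K + 1)) ∈ D
  · rw [if_pos h0, ← Finset.add_sum_erase D c h0]; simp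
  · rw [if_neg h0, Finset.erase_eq_of_notMem h0, sub_zero]

/-- Per pair with `i ≠ l`: `c_{(i l)k} − c_k = 1{k = i}(c_l − c_i) + 1{k = l}(c_i − c_l)`. [ours] -/
theorem swap_coeff_diff (c : Fin (K + 1) → ℝ) {i l : Fin (K + 1)} (hil : i ≠ l) (k : Fin (K + 1)) :
    c (Equiv.swap i l k) - c k = (if k = i then c l - c i else 0) + (if k = l then c i - c l else 0) := by
  by_cases hki : k = i
  · subst hki; rw [Equiv.swap_apply_left, if_pos rfl, if_neg hil]; ring
  · by_cases hkl : k = l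
    · subst hkl; rw [Equiv.swap_apply_right, if_neg hki, if_pos rfl]; ring
    · rw [Equiv.swap_apply_of_ne_of_ne hki hkl, if_neg hki, if_neg hkl]; ring

/-! ## §2 The vertex equations give an exact eigenfunction of the set chain -/

/-- **`Σ_{D'}Q(D,D')F(D') = (1−ρ)·F(D)`** for `F(D) = Σ_{k∈D}c_k` whenever `c` solves the vertex equations
`(t/m)Σ_r[1{k=i_r}(c_{l_r}−c_{i_r}) + 1{k=l_r}(c_{i_r}−c_{l_r})] − 1{k=0}hc_0 = −ρc_k` (distinct endpoints). [ours] -/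
theorem graphStale_weight_eigen (hm : 1 ≤ m) (he : ∀ r, (e r).1 ≠ (e r).2)
    (hQ : ∀ D D', Q D D' = (∑ r : Fin m, t / m * (if D' = D.image (Equiv.swap (e r).1 (e r).2) then (1 : ℝ) else 0))
      + h * (if D' = D.erase 0 then (1 : ℝ) else 0) + (1 - t - h) * (if D' = D then (1 : ℝ) else 0))
    {ρ : ℝ} (hvertex : ∀ k : Fin (K + 1), t / m * ∑ r : Fin m, ((if k = (e r).1 then c (e r).2 - c (e r).1 else 0) + (if k = (e r).2 then c (e r).1 - c (e r).2 else 0))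
      - (if k = 0 then h * c 0 else 0) = -ρ * c k) (D : Finset (Fin (K + 1))) :
    ∑ D', Q D D' * ∑ k ∈ D', c k = (1 - ρ) * ∑ k ∈ D, c k := by
  rw [graphStale_sum_mul e hQ D (fun D' => ∑ k ∈ D', c k)]
  simp_rw [staleWeight_image_swap c]
  rw [staleWeight_erase' c D]
  -- `Σ_r Σ_{k∈D} c((i l)k) = m·F(D) + Σ_{k∈D} Σ_r (c((i l)k) − c k)`
  have hswap : ∑ r : Fin m, ∑ k ∈ D, c (Equiv.swap (e r).1 (e r).2 k)
      = m * ∑ k ∈ D, c k + ∑ k ∈ D, ∑ r : Fin m, ((if k = (e r).1 then c (e r).2 - c (e r).1 else 0) + (if k = (e r).2 then c (e r).1 - c (e r).2 else 0)) := by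
    have e' : ∀ r : Fin m, ∑ k ∈ D, c (Equiv.swap (e r).1 (e r).2 k) = ∑ k ∈ D, c k + ∑ k ∈ D, (c (Equiv.swap (e r).1 (e r).2 k) - c k) := by
      intro r; rw [← sum_add_distrib]; exact sum_congr rfl fun k _ => by ring
    simp_rw [e']
    rw [sum_add_distrib, sum_const, card_univ, Fintype.card_fin, nsmul_eq_mul, sum_comm]
    congr 1
    exact sum_congr rfl fun k _ => sum_congr rfl fun r _ => swap_coeff_diff c (he r) k
  rw [hswap]
  have hhot : (if (0 : Fin (K + 1)) ∈ D then c 0 else 0) = ∑ k ∈ D, (if k = 0 then c 0 else 0) := by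
    by_cases h0D : (0 : Fin (K + 1)) ∈ D
    · rw [if_pos h0D, ← Finset.add_sum_erase D _ h0D, if_pos rfl]
      rw [sum_eq_zero fun k hk => if_neg (Finset.ne_of_mem_erase hk), add_zero]
    · rw [if_neg h0D]
      exact (sum_eq_zero fun k hk => if_neg fun h' => h0D (by rw [h'] at hk; exact hk)).symm
  rw [hhot]
  have hv : ∀ k ∈ D, t / m * ∑ r : Fin m, ((if k = (e r).1 then c (e r).2 - c (e r).1 else 0) + (if k = (e r).2 then c (e r).1 - c (e r).2 else 0))
      - h * (if k = 0 then c 0 else 0) = -ρ * c k := by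
    intro k _
    have := hvertex k
    have e' : h * (if k = 0 then c 0 else 0) = (if k = 0 then h * c 0 else 0) := by split_ifs <;> ring
    rw [e']; exact this
  have htot : t / m * ∑ k ∈ D, ∑ r : Fin m, ((if k = (e r).1 then c (e r).2 - c (e r).1 else 0) + (if k = (e r).2 then c (e r).1 - c (e r).2 else 0))
      - h * ∑ k ∈ D, (if k = 0 then c 0 else 0) = -ρ * ∑ k ∈ D, c k := by
    rw [mul_sum, mul_sum, mul_sum, ← sum_sub_distrib]
    exact sum_congr rfl hv
  have hmpos : (0 : ℝ) < m := Nat.cast_pos.mpr (by omega)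
  have e2 : t / m * ((m : ℝ) * ∑ k ∈ D, c k) = t * ∑ k ∈ D, c k := by field_simp
  linear_combination htot + e2

/-- **`E_{D_0}[F(D_n)] = (1−ρ)ⁿ·F(D_0)`** (`m ≥ 1`, `t, h ≥ 0`, `t + h ≤ 1`, `0 < ρ ≤ 1`). [ours] -/
theorem graphStale_weight_lawAt (hm : 1 ≤ m) (he : ∀ r, (e r).1 ≠ (e r).2) (ht0 : 0 ≤ t) (hh0 : 0 ≤ h) (hth : t + h ≤ 1)
    (hQ : ∀ D D', Q D D' = (∑ r : Fin m, t / m * (if D' = D.image (Equiv.swap (e r).1 (e r).2) then (1 : ℝ) else 0))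
      + h * (if D' = D.erase 0 then (1 : ℝ) else 0) + (1 - t - h) * (if D' = D then (1 : ℝ) else 0))
    {ρ : ℝ} (hρ0 : 0 < ρ) (hρ1 : ρ ≤ 1)
    (hvertex : ∀ k : Fin (K + 1), t / m * ∑ r : Fin m, ((if k = (e r).1 then c (e r).2 - c (e r).1 else 0) + (if k = (e r).2 then c (e r).1 - c (e r).2 else 0))
      - (if k = 0 then h * c 0 else 0) = -ρ * c k) (D₀ : Finset (Fin (K + 1))) (n : ℕ) :
    lawMean (lawAt Q (Pi.single D₀ 1) n) (fun D => ∑ k ∈ D, c k) = (1 - ρ) ^ n * ∑ k ∈ D₀, c k := by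
  have hQst := graphStale_isRowStochastic e hm ht0 hh0 hth hQ
  have heig : ∀ D, |∑ D', Q D D' * (∑ k ∈ D', c k) - (1 - ρ) * ∑ k ∈ D, c k| ≤ 0 := fun D => by
    rw [graphStale_weight_eigen e hm he hQ hvertex D, sub_self, abs_zero]
  have h' := approxEigen_lawMean_lawAt (P := Q) (Φ := fun D : Finset (Fin (K + 1)) => ∑ k ∈ D, c k) (lam := 1 - ρ) (δ := 0) hQst heig
    (by linarith) (by linarith) D₀ n
  rw [zero_div] at h'
  have := abs_nonpos_iff.mp h'
  linarith [this, sub_eq_zero.mp this]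

/-- **SURVIVAL OF STALENESS ON ANY SWAP LIST: `P_{D_0}(D_n ≠ ∅) ≤ (1−ρ)ⁿ·F(D_0)/c_min`** when every `c_k ≥ c_min > 0`. [ours] -/
theorem graphStale_nonempty_le (hm : 1 ≤ m) (he : ∀ r, (e r).1 ≠ (e r).2) (ht0 : 0 ≤ t) (hh0 : 0 ≤ h) (hth : t + h ≤ 1)
    (hQ : ∀ D D', Q D D' = (∑ r : Fin m, t / m * (if D' = D.image (Equiv.swap (e r).1 (e r).2) then (1 : ℝ) else 0))
      + h * (if D' = D.erase 0 then (1 : ℝ) else 0) + (1 - t - h) * (if D' = D then (1 : ℝ) else 0))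
    {ρ : ℝ} (hρ0 : 0 < ρ) (hρ1 : ρ ≤ 1)
    (hvertex : ∀ k : Fin (K + 1), t / m * ∑ r : Fin m, ((if k = (e r).1 then c (e r).2 - c (e r).1 else 0) + (if k = (e r).2 then c (e r).1 - c (e r).2 else 0))
      - (if k = 0 then h * c 0 else 0) = -ρ * c k) {cmin : ℝ} (hcmin : 0 < cmin) (hcge : ∀ k : Fin (K + 1), cmin ≤ c k)
    (D₀ : Finset (Fin (K + 1))) (n : ℕ) :
    ∑ D ∈ univ.filter (fun D : Finset (Fin (K + 1)) => D ≠ ∅), lawAt Q (Pi.single D₀ 1) n D ≤ (1 - ρ) ^ n * (∑ k ∈ D₀, c k) / cmin := by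
  have hQst := graphStale_isRowStochastic e hm ht0 hh0 hth hQ
  have hμ0 : ∀ D, 0 ≤ (Pi.single D₀ (1 : ℝ) : Finset (Fin (K + 1)) → ℝ) D := fun D => by rw [Pi.single_apply]; split_ifs <;> norm_num
  have hl0 : ∀ D, 0 ≤ lawAt Q (Pi.single D₀ 1) n D := fun D => lawAt_nonneg hQst hμ0 n D
  have hmean := graphStale_weight_lawAt e hm he ht0 hh0 hth hQ hρ0 hρ1 hvertex D₀ n
  have hF : ∀ D : Finset (Fin (K + 1)), D ≠ ∅ → cmin ≤ ∑ k ∈ D, c k := by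
    intro D hD
    obtain ⟨k, hk⟩ := Finset.nonempty_iff_ne_empty.mpr hD
    calc cmin ≤ c k := hcge k
      _ ≤ ∑ k ∈ D, c k := Finset.single_le_sum (fun k _ => le_trans hcmin.le (hcge k)) hk
  rw [le_div_iff₀ hcmin, ← hmean]
  unfold lawMean
  rw [sum_mul]
  calc ∑ D ∈ univ.filter (fun D : Finset (Fin (K + 1)) => D ≠ ∅), lawAt Q (Pi.single D₀ 1) n D * cmin
      ≤ ∑ D ∈ univ.filter (fun D : Finset (Fin (K + 1)) => D ≠ ∅), lawAt Q (Pi.single D₀ 1) n D * ∑ k ∈ D, c k :=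
        sum_le_sum fun D hD => mul_le_mul_of_nonneg_left (hF D (Finset.mem_filter.mp hD).2) (hl0 D)
    _ ≤ ∑ D, lawAt Q (Pi.single D₀ 1) n D * ∑ k ∈ D, c k := by
        refine Finset.sum_le_univ_sum_of_nonneg fun D => ?_
        by_cases hD : D = ∅
        · rw [hD]; simp
        · exact mul_nonneg (hl0 D) (le_trans hcmin.le (hF D hD))

end GraphStale

end Summit.Ventures.LatticeQCDFlow.Scaling

end
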